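import Literature.AlgebraicGeometry.Resolution.ProjectiveResolutionProofs
import Literature.AlgebraicGeometry.Resolution.AlterationsBlowupDivisorProofs
import Literature.AlgebraicGeometry.Resolution.KollarStepThreeData
import Literature.AlgebraicGeometry.Resolution.SmoothOfRegularPerfectField
import Literature.AlgebraicGeometry.Resolution.AlterationsDimension
import Literature.AlgebraicGeometry.Resolution.AlterationsLemma32
import Literature.AlgebraicGeometry.HodgeTheory.SupportedHodgeClassesAlgebraic
import Literature.AlgebraicGeometry.HodgeTheory.GysinFormalismPushforward
import HarnessLib

/-!
# Route LimitExtension · `MiddleDivisorSupportSuffices` (stmt-HodgeConjecture-10865):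
# the snc bridge, resolution side — the modification and the components of the boundary

Companion to `Theorems/LimitExtensionMiddleDivisorSupportSufficesModification.lean`, which proves
the item (and route decl `DivisorInduction`, stmt-HodgeConjecture-1082) from the pencil crux and
MODIFICATION DATA: for every closed `Z` of codimension `≥ 1` in a smooth projective complex
`(n+1)`-fold `X`, a birational `π : X' ⟶ X` of smooth projective `(n+1)`-folds and a finite family
of morphisms from smooth projective `n`-folds covering `π⁻¹(Z)` for which Deligne's Prop. 8.2.7
holds in Čech form on `X'`. The snc bridge constructs such data from the tree's PROVED log
resolution (`Literature.AlgebraicGeometry.Resolution.exists_logResolution_of_isClosed`, Kollár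
Thm. 3.21) and the snc principle of two types (Prop. 8.2.7 for the members of an snc boundary only).
This file is its scheme-theoretic half (all PROVED; no definitions, no named facts):

* `isProjectiveOver_of_isMultipleBlowup` — iterated blow-ups of projective `k`-schemes are
  projective over `k` (Hartshorne II 7.16 (c), by induction on `IsMultipleBlowup` with the tree's
  `IsBlowup.isProjectiveOver`), so that the log resolution has projective total space;
* `isSmoothProjective_and_isBirational_of_modification` — a regular integral modification of a
  smooth projective `(n+1)`-fold, projective over `ℂ` and an isomorphism over the non-empty open
  `X ∖ Z`, is a birational morphism of smooth projective `(n+1)`-folds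
  (`smooth_of_isRegular_of_perfectField`; the dimension through the dense open;
  `geometricallyIntegral_of_isAlgClosed`);
* `exists_family_of_hasSNC` — the irreducible components of the members of an snc boundary
  (`Kollar2007.boundaryPieces`; the split boundary keeps simple normal crossings,
  `HasSNCWith.split`, so every component is a regular scheme, `HasSNCWith.isRegular_subscheme`)
  as closed immersions of smooth projective varieties of dimension `≤ n`, with the bookkeeping
  between supports and images.

The cohomological half (Prop. 8.2.7 for that family from the snc principle; padding to `n`-folds)
is `…SNCBridgeCohomology.lean`; the assembly is `…SNCPrinciple.lean`.

## References

* [Kollar2007] J. Kollár, Lectures on Resolution of Singularities (2007), Thm. 3.21 (p. 124),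
  Def. 3.24, (3.111) Step 3.
* [BierstoneGrigorievMilmanWlodarczyk2011] E. Bierstone, D. Grigoriev, P. Milman, J. Włodarczyk,
  Effective Hironaka resolution and its complexity, Asian J. Math. 15 (2011), §4 Step 2.
* [Hartshorne1977] R. Hartshorne, Algebraic Geometry (1977), II Prop. 7.16 (c), II Ex. 3.20.
-/

-- `Summit.HodgeConjecture.HodgeConjecture.Theorems` is the mandated namespace (single-conjunct summit:
-- Sub = Summit), which `linter.dupNamespace` flags; off tree-wide in the lakefile, restated here so
-- stand-alone elaboration is warning-free too.
set_option linter.dupNamespace false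

noncomputable section

open CategoryTheory CategoryTheory.Limits AlgebraicGeometry TopologicalSpace
open MonoidalCategory CartesianMonoidalCategory
open Literature.AlgebraicTopology.SingularHomology
open Literature.AlgebraicGeometry.Resolution Literature.AlgebraicGeometry.Motives
open Literature.AlgebraicGeometry.HodgeTheory

namespace Summit.HodgeConjecture.HodgeConjecture.Theorems

universe u

/-! ### Step B: iterated blow-ups of projective schemes; the modification as a birational morphism -/

/-- **A multiple blow-up of a projective `k`-scheme is projective over `k`**: each step is a
blow-up, and blow-ups of projective `k`-schemes are projective (Hartshorne II Prop. 7.16 (c); the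
tree's `IsBlowup.isProjectiveOver`), cf. `IsEmbeddedTransform.isProjectiveOver`.
[cite: Hartshorne1977, II Prop. 7.16 (c)] -/
theorem isProjectiveOver_of_isMultipleBlowup {k : Type u} [Field k] {X : Scheme.{u}}
    (s : X ⟶ Spec (.of k)) (hX : IsProjectiveOver (Over.mk s))
    {M : MarkedIdeal X} {X' : Scheme.{u}} {σ : X' ⟶ X} {M' : MarkedIdeal X'}
    (h : IsMultipleBlowup M σ M') : IsProjectiveOver (Over.mk (σ ≫ s)) := by
  induction h with
  | refl => simpa using hX
  | blowup h C τ hτ hC hsupp hsnc ih =>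
    have := hτ.isProjectiveOver _ ih
    simpa only [Category.assoc] using this


/-- **A proper regular modification of a smooth projective complex `(n+1)`-fold which is an
isomorphism over a non-empty open and projective over `ℂ` is a birational morphism of smooth
projective `(n+1)`-folds** (the shape in which the tree's log resolution
`Resolution.exists_logResolution_of_isClosed` hands over its total space): `X'` is smooth over `ℂ`
because regular (`smooth_of_isRegular_of_perfectField`), of dimension `n + 1` because isomorphic to
`X` over the dense open `X ∖ Z` (`topologicalKrullDim_eq_of_isOpenImmersion`), and geometrically
irreducible because integral over `ℂ = ℂ̄` (`geometricallyIntegral_of_isAlgClosed`).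
[cite: Kollar2007, Thm. 3.21 (p. 124)] [cite: Hartshorne1977, II Ex. 3.20] -/
theorem isSmoothProjective_and_isBirational_of_modification {n : ℕ} {X : SchemeOver ℂ}
    (hX : IsSmoothProjective (n + 1) X) {Z : Set X.left} (hZ : IsClosed Z) (hZne : Z ≠ Set.univ)
    {W' : Scheme.{0}} (f : W' ⟶ X.left) [IsIntegral W'] (hreg : Scheme.IsRegular W')
    [IsIso (f ∣_ ⟨Zᶜ, hZ.isOpen_compl⟩)] (hprojW' : IsProjectiveOver (Over.mk (f ≫ X.hom))) :
    IsSmoothProjective (n + 1) (Over.mk (f ≫ X.hom) : SchemeOver ℂ) ∧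
      Literature.AlgebraicGeometry.Resolution.IsBirational f := by
  classical
  haveI := hX.smoothOfRelativeDimension
  haveI : Smooth X.hom := SmoothOfRelativeDimension.smooth (n + 1) X.hom
  haveI := hX.geometricallyIrreducible
  haveI : IrreducibleSpace X.left := GeometricallyIrreducible.irreducibleSpace_of_subsingleton X.hom
  haveI : IsProper X.hom := IsSmoothProjective.isProper_holds hX
  haveI : IsLocallyNoetherian X.left := LocallyOfFiniteType.isLocallyNoetherian X.hom
  haveI : IsReduced X.left :=
    (Scheme.IsRegular.of_smooth X.hom (Scheme.isRegular_Spec (CommRingCat.of ℂ))).isReduced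
  haveI : IsIntegral X.left := isIntegral_of_irreducibleSpace_of_isReduced X.left
  -- `W'` is smooth over `ℂ` of some relative dimension `d`
  haveI : IsProper (f ≫ X.hom) :=
    IsProjectiveOver.isProper (X := (Over.mk (f ≫ X.hom) : SchemeOver ℂ)) hprojW'
  haveI : Smooth (f ≫ X.hom) := smooth_of_isRegular_of_perfectField (f ≫ X.hom) hreg
  obtain ⟨d, hd⟩ := exists_smoothOfRelativeDimension_of_smooth (f ≫ X.hom)
  haveI := hd
  -- `d = n + 1`: `W' ⊇ f⁻¹(X ∖ Z) ≅ X ∖ Z ⊆ X`, non-empty opens of irreducible varieties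
  set U : X.left.Opens := ⟨Zᶜ, hZ.isOpen_compl⟩ with hUdef
  have hUne : (U : Set X.left).Nonempty := by
    rw [Set.nonempty_iff_ne_empty]
    intro h
    apply hZne
    have h' : (Zᶜ : Set X.left) = ∅ := h
    rw [← compl_compl Z, h', Set.compl_empty]
  haveI : Nonempty U := by
    obtain ⟨x, hx⟩ := hUne
    exact ⟨⟨x, hx⟩⟩
  haveI hne' : Nonempty (f ⁻¹ᵁ U) := by
    obtain ⟨u⟩ := (inferInstance : Nonempty U)
    obtain ⟨u', _⟩ := (Scheme.homeoOfIso (asIso (f ∣_ U))).surjective u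
    exact ⟨u'⟩
  have hdim : d = n + 1 := by
    have h1 : topologicalKrullDim X.left = ((n + 1 : ℕ) : WithBot ℕ∞) :=
      topologicalKrullDim_eq_of_smoothOfRelativeDimension X.hom (n + 1)
    have h2 : topologicalKrullDim W' = (d : WithBot ℕ∞) :=
      topologicalKrullDim_eq_of_smoothOfRelativeDimension (f ≫ X.hom) d
    have h3 : topologicalKrullDim U = topologicalKrullDim X.left :=
      topologicalKrullDim_eq_of_isOpenImmersion X.hom U.ι
    have h4 : topologicalKrullDim ↥(f ⁻¹ᵁ U) = topologicalKrullDim W' :=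
      topologicalKrullDim_eq_of_isOpenImmersion (f ≫ X.hom) (f ⁻¹ᵁ U).ι
    have h5 : topologicalKrullDim ↥(f ⁻¹ᵁ U) = topologicalKrullDim U :=
      IsHomeomorph.topologicalKrullDim_eq (f ∣_ U).base
        (Scheme.homeoOfIso (asIso (f ∣_ U))).isHomeomorph
    rw [h4, h2, h3, h1] at h5
    exact_mod_cast h5
  subst hdim
  haveI := geometricallyIntegral_of_isAlgClosed (f ≫ X.hom)
  have hgi : GeometricallyIrreducible (f ≫ X.hom) := inferInstance
  refine ⟨⟨hd, hprojW', hgi⟩, U, U.2.dense hUne, ?_, inferInstance⟩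
  obtain ⟨u'⟩ := hne'
  exact (f ⁻¹ᵁ U).2.dense ⟨u'.1, u'.2⟩

/-! ### Step C: the components of an snc boundary as smooth projective subvarieties -/

/-- **The irreducible components of the members of an snc boundary on a smooth projective
`(n+1)`-fold, as closed immersions of smooth projective varieties of dimension `≤ n`.** Split
every member `K` of `E` into its irreducible components (`Kollar2007.boundaryPieces`; they are
pairwise disjoint and the split list `Es` still has simple normal crossings,
`HasSNCWith.split`); a component `Zc`, with its reduced structure (`ClosedSubvariety.ofPoint` of
its generic point), is a member of `Es`, hence a REGULAR scheme
(`HasSNCWith.isRegular_subscheme`), hence smooth over `ℂ` (`smooth_of_isRegular_of_perfectField`),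
projective (closed in `X'`) and geometrically irreducible (integral over `ℂ̄ = ℂ`); its dimension
is `< n + 1` as soon as the boundary is not all of `X'` (`one_le_coheight_of_mem_of_isClosed`,
`height + coheight = n + 1`). Returned: the split boundary `Es`, the family `g i : Y i ⟶ X'`,
and the bookkeeping identities between supports and images.
[cite: BierstoneGrigorievMilmanWlodarczyk2011, §4 Step 2 (p. 12)] [cite: Kollar2007, Def. 3.24 and (3.111) Step 3]
[cite: Hartshorne1977, II Ex. 3.20] -/
theorem exists_family_of_hasSNC {n : ℕ} {X' : SchemeOver ℂ} (hX' : IsSmoothProjective (n + 1) X')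
    (E : List X'.left.IdealSheafData) (hE : HasSNC E)
    (hEne : (⋃ D ∈ E, ((D.support : Set X'.left))) ≠ Set.univ) :
    ∃ (Es : List X'.left.IdealSheafData) (_ : HasSNC Es) (ι : Type) (_ : Finite ι) (m : ι → ℕ)
      (Y : ι → SchemeOver ℂ) (_ : ∀ i, IsSmoothProjective (m i) (Y i)) (g : ∀ i, Y i ⟶ X'),
      (∀ i, m i ≤ n) ∧ (∀ i, IsClosedImmersion (g i).left) ∧
      (⋃ D ∈ E, ((D.support : Set X'.left))) = ⋃ i, Set.range (g i).left.base ∧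
      (∀ P ∈ Es, ∃ i, ((P.support : Set X'.left)) = Set.range (g i).left.base) ∧
      (∀ i, ∃ P ∈ Es, ((P.support : Set X'.left)) = Set.range (g i).left.base) := by
  classical
  -- instances on `X'`
  haveI := hX'.smoothOfRelativeDimension
  haveI : Smooth X'.hom := SmoothOfRelativeDimension.smooth (n + 1) X'.hom
  haveI : IsProper X'.hom := IsSmoothProjective.isProper_holds hX'
  haveI : IsLocallyNoetherian X'.left := LocallyOfFiniteType.isLocallyNoetherian X'.hom
  haveI : CompactSpace X'.left := IsSmoothProjective.compactSpace_holds hX'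
  haveI : IsNoetherian X'.left := {}
  haveI : NoetherianSpace X'.left := inferInstance
  haveI : IsIntegral X'.left := IsSmoothProjective.isIntegral_holds hX'
  -- the split boundary
  set Es : List X'.left.IdealSheafData :=
    E.flatMap fun K => pieceIdeals (Kollar2007.boundaryPieces K) with hEsdef
  have hEs : HasSNC Es := hE.split _ fun K hK => hE.isPiecePartition_boundaryPieces hK
  -- the closed set `T = ⋃ V(D)` of the boundary
  have hTclosed : IsClosed (⋃ D ∈ E, ((D.support : Set X'.left))) :=
    (List.finite_toSet E).isClosed_biUnion fun D _ => D.support.isClosed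
  -- the index set: the components of the members
  set S : Set (Closeds X'.left) := {Zc | ∃ K ∈ E, Zc ∈ Kollar2007.boundaryPieces K} with hSdef
  have hSfin : S.Finite := by
    have hS' : S = ⋃ K ∈ {K | K ∈ E}, {Zc | Zc ∈ Kollar2007.boundaryPieces K} := by
      ext Zc; simp [hSdef]
    rw [hS']
    exact (List.finite_toSet E).biUnion fun K _ => List.finite_toSet _
  -- each component as a smooth projective subvariety of dimension `≤ n`
  have key : ∀ Zc ∈ S, ∃ (m : ℕ) (Y : SchemeOver ℂ) (_ : IsSmoothProjective m Y) (g : Y ⟶ X')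
      (_ : IsClosedImmersion g.left), Set.range g.left.base = (Zc : Set X'.left) ∧ m ≤ n := by
    rintro Zc ⟨K, hK, hZc⟩
    have hcomp := Kollar2007.mem_boundaryPieces_iff.mp hZc
    have hirr : IsIrreducible (Zc : Set X'.left) := componentsIn.isIrreducible hcomp
    have hsub : (Zc : Set X'.left) ⊆ K.support := componentsIn.subset hcomp
    -- the generic point and the reduced closed subscheme structure
    set η : X'.left := hirr.genericPoint with hηdef
    have hηcl : closure ({η} : Set X'.left) = Zc := hirr.closure_genericPoint Zc.isClosed
    have hηmem : η ∈ (Zc : Set X'.left) := by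
      rw [← hηcl]; exact subset_closure (Set.mem_singleton η)
    set W := Literature.AlgebraicGeometry.Motives.ClosedSubvariety.ofPoint X'.left η with hWdef
    -- `W` is regular: it is the member `I(Zc)` of the snc boundary `Es`
    have hPmem : Scheme.IdealSheafData.vanishingIdeal Zc ∈ Es :=
      List.mem_flatMap.mpr ⟨K, hK, mem_pieceIdeals_iff.mpr ⟨Zc, hZc, rfl⟩⟩
    have hregP : Scheme.IsRegular (Scheme.IdealSheafData.vanishingIdeal Zc).subscheme :=
      (hEs.hasSNCWith_self _ hPmem).isRegular_subscheme
    have hcl : (⟨closure ({η} : Set X'.left), isClosed_closure⟩ : Closeds X'.left) = Zc :=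
      Closeds.ext hηcl
    have hregW : Scheme.IsRegular W.carrier := by
      change Scheme.IsRegular
        (Scheme.IdealSheafData.vanishingIdeal
          (⟨closure ({η} : Set X'.left), isClosed_closure⟩ : Closeds X'.left)).subscheme
      rw [hcl]
      exact hregP
    -- `W` over `ℂ`: smooth of some relative dimension `m`, projective, geometrically irreducible
    haveI : IsClosedImmersion W.ιOver.left := inferInstanceAs (IsClosedImmersion W.ι)
    haveI : LocallyOfFiniteType W.toSchemeOver.hom :=
      inferInstanceAs (LocallyOfFiniteType (W.ι ≫ X'.hom))
    haveI : Smooth W.toSchemeOver.hom := smooth_of_isRegular_of_perfectField _ hregW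
    haveI : IrreducibleSpace W.toSchemeOver.left := inferInstanceAs (IrreducibleSpace W.carrier)
    haveI : IsIntegral W.toSchemeOver.left := inferInstanceAs (IsIntegral W.carrier)
    obtain ⟨m, hm⟩ := exists_smoothOfRelativeDimension_of_smooth W.toSchemeOver.hom
    have hproj : IsProjectiveOver W.toSchemeOver := isProjectiveOver_toSchemeOver W hX'.isProjectiveOver
    haveI := geometricallyIntegral_of_isAlgClosed W.toSchemeOver.hom
    have hgi : GeometricallyIrreducible W.toSchemeOver.hom := inferInstance
    have hY : IsSmoothProjective m W.toSchemeOver := ⟨hm, hproj, hgi⟩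
    -- the image is `Zc`
    have hrange : Set.range W.ιOver.left.base = (Zc : Set X'.left) := by
      rw [← hηcl]
      exact Literature.AlgebraicGeometry.Motives.ClosedSubvariety.range_ofPoint_ι (X := X'.left) η
    -- dimension `m ≤ n`
    have hmn : m ≤ n := by
      -- `height η = m` in `X'`
      obtain ⟨a, c, ha, hc, hac⟩ :=
        exists_height_eq_coheight_eq hY (genericPoint W.toSchemeOver.left)
      have hc0 : c = 0 := by
        have h0 : Order.coheight (genericPoint W.toSchemeOver.left) = 0 := by
          rw [Order.coheight_eq_zero]
          intro b _
          exact AlgebraicGeometry.Scheme.le_iff_specializes.2 (genericPoint_specializes b)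
        rw [h0] at hc
        exact_mod_cast hc.symm
      have hηa : Order.height η = (a : ℕ∞) := by
        have e1 : W.ι.base (genericPoint W.toSchemeOver.left) = η :=
          Literature.AlgebraicGeometry.Motives.ClosedSubvariety.genericPoint_ofPoint (X := X'.left) η
        rw [← e1, Literature.AlgebraicGeometry.Motives.Scheme.height_base_eq_of_isClosedImmersion]
        exact ha
      obtain ⟨a', c', ha', hc', hac'⟩ := exists_height_eq_coheight_eq hX' η
      have h1 : (1 : ℕ∞) ≤ Order.coheight η :=
        one_le_coheight_of_mem_of_isClosed hX' hTclosed hEne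
          (Set.mem_biUnion hK (hsub hηmem))
      rw [hc'] at h1
      rw [hηa] at ha'
      have e2 : a = a' := by exact_mod_cast ha'
      have e3 : 1 ≤ c' := by exact_mod_cast h1
      omega
    exact ⟨m, W.toSchemeOver, hY, W.ιOver, inferInstance, hrange, hmn⟩
  choose m Y hY g hg hrange hmn using key
  -- assemble, indexed by the subtype of `S`
  refine ⟨Es, hEs, S, hSfin.to_subtype, fun i => m i.1 i.2, fun i => Y i.1 i.2,
    fun i => hY i.1 i.2, fun i => g i.1 i.2, fun i => hmn i.1 i.2, fun i => hg i.1 i.2, ?_, ?_, ?_⟩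
  · -- `⋃ V(D) = ⋃ images`
    ext x
    simp only [Set.mem_iUnion, Set.mem_range]
    constructor
    · rintro ⟨D, hD, hx⟩
      obtain ⟨Zc, hZc, hxZ⟩ := (hE.isPiecePartition_boundaryPieces hD).exists_mem hx
      refine ⟨⟨Zc, D, hD, hZc⟩, ?_⟩
      have : x ∈ Set.range (g Zc ⟨D, hD, hZc⟩).left.base := by rw [hrange]; exact hxZ
      exact this
    · rintro ⟨⟨Zc, D, hD, hZc⟩, hx⟩
      have hx' : x ∈ (Zc : Set X'.left) := by rw [← hrange Zc ⟨D, hD, hZc⟩]; exact hx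
      exact ⟨D, hD, (hE.isPiecePartition_boundaryPieces hD).subset hZc hx'⟩
  · -- every member of `Es` is the image of some `g i`
    intro P hP
    obtain ⟨K, hK, hP'⟩ := List.mem_flatMap.mp hP
    obtain ⟨Zc, hZc, rfl⟩ := mem_pieceIdeals_iff.mp hP'
    exact ⟨⟨Zc, K, hK, hZc⟩, by rw [coe_support_vanishingIdeal, hrange]⟩
  · -- every `g i` is the support of some member of `Es`
    rintro ⟨Zc, K, hK, hZc⟩
    exact ⟨Scheme.IdealSheafData.vanishingIdeal Zc,
      List.mem_flatMap.mpr ⟨K, hK, mem_pieceIdeals_iff.mpr ⟨Zc, hZc, rfl⟩⟩,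
      by rw [coe_support_vanishingIdeal, hrange]⟩

end Summit.HodgeConjecture.HodgeConjecture.Theorems

end
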